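import Literature.Analysis.FunctionSpaces.TorusPeriodizationCube
import Literature.Analysis.FunctionSpaces.HolderInterpolation
import HarnessLib

/-!
# Planar evolutions supported in the open unit cube, read on the flat torus

Analysis/FunctionSpaces support file (notion `flat_torus_T3`): the dictionary between a
time-dependent planar field `u : ℝ → ℝ^d → F`, `C^∞` on `S × ℝ^d` for a time set `S ⊆ ℝ` and
vanishing, for `t ∈ S`, off a closed set `K` contained in the open unit cube `(0,1)^d`, and its
slice-wise periodisation `U t := Torus.periodize (u t)` on `T^d` — the identification "we can
make both `ρ_n` and `v_n` `1`-periodic, hence defined on the `2d`-torus" of Bruè–De Lellis 2023,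
§5 (first paragraph), applied to the planar family of their Thm. 4.1:

* values: `U t x = u t (repr x)` (`periodize_slice_apply`); joint smoothness on `S × T^d`
  (`isSmoothSpaceTimeOn_periodize`); one-sided time derivatives, gradients, Fréchet derivatives,
  the convective term and incompressibility are those of `u` read at `repr x`
  (`timeDerivWithin_periodize_slice`, `gradient_periodize_slice`, `fderiv_periodize_slice`,
  `convect_periodize_slice`, `isDivFree_periodize_slice`);
* the lift of the slice `x ↦ ∂ₜᵏ|_S U(·, x)(t)` is the periodisation of the planar slice
  `z ↦ ∂ₜᵏ|_S u(·, z)(t)` (`lift_iteratedDerivWithin_periodize`), whence its `C^{j,r}(T^d)` norm is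
  bounded by sup bounds of the planar derivatives `Dⁱ ∂ₜᵏ u`, `i ≤ j + 1`
  (`eContDiffHolderNorm_iteratedDerivWithin_periodize_le`, via
  `eContDiffHolderNorm_le_of_norm_iteratedFDeriv_le` of `HolderInterpolation`);
* integrals: `∫_{T^d} U t = ∫_{ℝ^d} u t`, `∫_{T^d} (U t)² = ∫_{ℝ^d} (u t)²`
  (`integral_periodize_slice`, `integral_periodize_slice_sq`).

## References

* E. Bruè, C. De Lellis, Comm. Math. Phys. 400 (2023), Thm. 4.1 and §5, first paragraph
  (arXiv:2207.06301, pp. 9–10).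
* L. Grafakos, *Classical Fourier Analysis*, 3rd ed. (2014), §3.1.1.
-/

noncomputable section

open Set Function Filter Metric MeasureTheory
open _root_.Topology
open scoped ContDiff NNReal ENNReal InnerProductSpace

namespace Literature.Analysis.FunctionSpaces

namespace Torus

variable {d : Type*} [Fintype d] [DecidableEq d]
variable {F : Type*} [NormedAddCommGroup F] [NormedSpace ℝ F]

section Field

variable {S : Set ℝ} {u : ℝ → EuclideanSpace ℝ d → F} {K : Set (EuclideanSpace ℝ d)}

omit [Fintype d] [DecidableEq d] [NormedSpace ℝ F] in
/-- If `u t` vanishes off a closed `K` inside the open unit cube, its topological support lies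
in the open unit cube. [folklore] -/
theorem tsupport_slice_subset_openCube (hK : IsClosed K)
    (hKsub : K ⊆ {y | ∀ i, y i ∈ Ioo (0 : ℝ) 1}) {t : ℝ} (h0 : ∀ y ∉ K, u t y = 0) :
    tsupport (u t) ⊆ {y | ∀ i, y i ∈ Ioo (0 : ℝ) 1} :=
  (closure_minimal (fun y hy => by_contra fun hc => (Function.mem_support.1 hy) (h0 y hc)) hK).trans
    hKsub

omit [NormedSpace ℝ F] in
/-- **Values.** For `u t` vanishing off a closed `K ⊆ (0,1)^d`:
`periodize (u t) x = u t (repr x)`. [folklore] -/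
theorem periodize_slice_apply (hK : IsClosed K) (hKsub : K ⊆ {y | ∀ i, y i ∈ Ioo (0 : ℝ) 1})
    {t : ℝ} (h0 : ∀ y ∉ K, u t y = 0) (x : UnitAddTorus d) :
    periodize (u t) x = u t (repr x) :=
  periodize_eq_apply_repr
    (eq_zero_of_tsupport_subset_openCube (tsupport_slice_subset_openCube hK hKsub h0)) x

/-- **Joint smoothness.** If `u` is `C^∞` on `S × ℝ^d` and `u t`, `t ∈ S`, vanishes off a closed
`K ⊆ (0,1)^d`, then `t ↦ periodize (u t)` is jointly smooth on `S × T^d` (near each point of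
`S × ℝ^d` the space-periodised field is a fixed finite sum of translates). [folklore] -/
theorem isSmoothSpaceTimeOn_periodize (hu : ContDiffOn ℝ ∞ (uncurry u) (S ×ˢ univ))
    (hK : IsClosed K) (hKsub : K ⊆ {y | ∀ i, y i ∈ Ioo (0 : ℝ) 1})
    (h0 : ∀ t ∈ S, ∀ y ∉ K, u t y = 0) :
    IsSmoothSpaceTimeOn S fun t => periodize (u t) := by
  unfold IsSmoothSpaceTimeOn
  rw [stLift_periodize]
  intro p hp
  obtain ⟨m, hm⟩ := exists_nat_ge ((Fintype.card d : ℝ) + (‖p.2‖ + 1))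
  have hR : ∀ s ∈ S, support (u s) ⊆ closedBall 0 (Fintype.card d) := fun s hs =>
    support_subset_closedBall_of_cube (eq_zero_of_tsupport_subset_openCube
      (tsupport_slice_subset_openCube hK hKsub (h0 s hs)))
  -- on a neighbourhood within `S ×ˢ univ`, the periodised field is a fixed finite sum
  have hev : (uncurry fun t y => perSum (u t) y) =ᶠ[𝓝[S ×ˢ univ] p]
      fun q => ∑ k ∈ latticeWindow d m, uncurry u (q.1, q.2 + latticeVec k) := by
    have h1 : ∀ᶠ q : ℝ × EuclideanSpace ℝ d in 𝓝[S ×ˢ univ] p, dist q.2 p.2 < 1 ∧ q ∈ S ×ˢ univ :=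
      ((continuous_snd.continuousWithinAt.tendsto.eventually (ball_mem_nhds p.2 one_pos)).and
        self_mem_nhdsWithin)
    filter_upwards [h1] with q hq
    refine perSum_eq_sum (hR q.1 hq.2.1) ?_ hm
    rw [dist_eq_norm] at hq
    linarith [norm_le_norm_add_norm_sub' q.2 p.2, norm_sub_rev q.2 p.2]
  refine (ContDiffWithinAt.congr_of_eventuallyEq ?_ hev ?_)
  · refine ContDiffWithinAt.sum fun k _ => ?_
    exact hu.comp (contDiffOn_fst.prodMk (contDiffOn_snd.add contDiffOn_const))
      (fun q hq => ⟨hq.1, mem_univ _⟩) p hp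
  · exact perSum_eq_sum (hR p.1 hp.1) (by linarith [norm_nonneg p.2]) hm

/-- Iterated one-sided time derivatives of the periodised field at `y ∈ ℝ^d` are those of the
planar field at the representative `repr (proj y)` (the two time slices agree on `S`).
[folklore] -/
theorem iteratedDerivWithin_perSum_slice (hK : IsClosed K)
    (hKsub : K ⊆ {y | ∀ i, y i ∈ Ioo (0 : ℝ) 1}) (h0 : ∀ t ∈ S, ∀ y ∉ K, u t y = 0) (k : ℕ)
    (y : EuclideanSpace ℝ d) {t : ℝ} (ht : t ∈ S) :
    iteratedDerivWithin k (fun s => perSum (u s) y) S t =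
      iteratedDerivWithin k (fun s => u s (repr (proj y))) S t :=
  iteratedDerivWithin_congr (fun s hs => perSum_eq_apply_repr_proj
    (eq_zero_of_tsupport_subset_openCube (tsupport_slice_subset_openCube hK hKsub (h0 s hs))) y) ht

omit [Fintype d] [DecidableEq d] in
/-- The planar slice `z ↦ ∂ₜᵏ|_S u(·, z)(t)` vanishes off `K` (for `z ∉ K` the time slice is
identically zero on `S`). [folklore] -/
theorem iteratedDerivWithin_slice_eq_zero (h0 : ∀ t ∈ S, ∀ y ∉ K, u t y = 0) (k : ℕ) {t : ℝ}
    (ht : t ∈ S) {z : EuclideanSpace ℝ d} (hz : z ∉ K) :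
    iteratedDerivWithin k (fun s => u s z) S t = 0 := by
  rw [iteratedDerivWithin_congr (f := fun s => u s z) (g := fun _ => (0 : F))
    (fun s hs => h0 s hs z hz) ht]
  simp

/-- **Lift of the time-derivative slices.** The lift of `x ↦ ∂ₜᵏ|_S U(·, x)(t)`,
`U = periodize ∘ u`, is the periodisation of the planar slice `z ↦ ∂ₜᵏ|_S u(·, z)(t)`.
[folklore] -/
theorem lift_iteratedDerivWithin_periodize (hK : IsClosed K)
    (hKsub : K ⊆ {y | ∀ i, y i ∈ Ioo (0 : ℝ) 1}) (h0 : ∀ t ∈ S, ∀ y ∉ K, u t y = 0) (k : ℕ)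
    {t : ℝ} (ht : t ∈ S) :
    lift (fun x => iteratedDerivWithin k (fun s => periodize (u s) x) S t) =
      perSum fun z => iteratedDerivWithin k (fun s => u s z) S t := by
  funext y
  have hW : ∀ z, (¬ ∀ i, z i ∈ Ioo (0 : ℝ) 1) → iteratedDerivWithin k (fun s => u s z) S t = 0 :=
    fun z hz => iteratedDerivWithin_slice_eq_zero h0 k ht fun hzK => hz (hKsub hzK)
  rw [lift_apply, perSum_eq_apply_repr_proj hW y]
  simp_rw [periodize_proj]
  exact iteratedDerivWithin_perSum_slice hK hKsub h0 k y ht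

omit [DecidableEq d] in
/-- The planar slices `z ↦ ∂ₜᵏ|_S u(·, z)(t)`, `t ∈ S`, are `C^∞` and have topological support
in the open unit cube. [folklore] -/
theorem contDiff_iteratedDerivWithin_slice_and_tsupport (hu : ContDiffOn ℝ ∞ (uncurry u) (S ×ˢ univ))
    (hS : UniqueDiffOn ℝ S) (hK : IsClosed K) (hKsub : K ⊆ {y | ∀ i, y i ∈ Ioo (0 : ℝ) 1})
    (h0 : ∀ t ∈ S, ∀ y ∉ K, u t y = 0) (k : ℕ) {t : ℝ} (ht : t ∈ S) :
    ContDiff ℝ ∞ (fun z => iteratedDerivWithin k (fun s => u s z) S t) ∧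
      tsupport (fun z => iteratedDerivWithin k (fun s => u s z) S t) ⊆
        {y | ∀ i, y i ∈ Ioo (0 : ℝ) 1} :=
  ⟨hu.contDiff_iteratedDerivWithin_slice hS k ht,
    (closure_minimal (fun _ hz => by_contra fun hc =>
      (Function.mem_support.1 hz) (iteratedDerivWithin_slice_eq_zero h0 k ht hc)) hK).trans hKsub⟩

/-- **Hölder norms of the time-derivative slices from planar sup bounds.** If
`‖Dⁱ(∂ₜᵏ|_S u(·,·)(t))(z)‖ ≤ Mᵢ` for `i ≤ j + 1` and all `z` (`Mᵢ ≥ 0`), then for `r ≤ 1` and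
any scale `δ > 0` the `C^{j,r}(T^d)` norm of `x ↦ ∂ₜᵏ|_S U(·, x)(t)` is at most
`Σ_{i ≤ j} Mᵢ + M_{j+1} δ^{1-r} + 2 M_j δ^{-r}` (Bruè–De Lellis 2023, Thm. 4.1 (a) at fractional
orders from the integer ones). [folklore] -/
theorem eContDiffHolderNorm_iteratedDerivWithin_periodize_le
    (hu : ContDiffOn ℝ ∞ (uncurry u) (S ×ˢ univ)) (hS : UniqueDiffOn ℝ S) (hK : IsClosed K)
    (hKsub : K ⊆ {y | ∀ i, y i ∈ Ioo (0 : ℝ) 1}) (h0 : ∀ t ∈ S, ∀ y ∉ K, u t y = 0)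
    {j k : ℕ} {t : ℝ} (ht : t ∈ S) {M : ℕ → ℝ} (hM0 : ∀ i, 0 ≤ M i)
    (hM : ∀ i ≤ j + 1, ∀ z,
      ‖iteratedFDeriv ℝ i (fun z => iteratedDerivWithin k (fun s => u s z) S t) z‖ ≤ M i)
    {r : ℝ≥0} (hr : r ≤ 1) {δ : ℝ} (hδ : 0 < δ) :
    Torus.eContDiffHolderNorm j r (fun x => iteratedDerivWithin k (fun s => periodize (u s) x) S t) ≤
      ENNReal.ofReal ((∑ i ∈ Finset.range (j + 1), M i) +
        (M (j + 1) * δ ^ (1 - r : ℝ) + 2 * M j * δ⁻¹ ^ (r : ℝ))) := by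
  obtain ⟨hW, hWs⟩ := contDiff_iteratedDerivWithin_slice_and_tsupport hu hS hK hKsub h0 k ht
  unfold Torus.eContDiffHolderNorm
  rw [lift_iteratedDerivWithin_periodize hK hKsub h0 k ht]
  refine eContDiffHolderNorm_le_of_norm_iteratedFDeriv_le
    ((contDiff_perSum hW (tsupport_subset_closedBall_of_openCube hWs)).of_le (by exact_mod_cast le_top))
    hM0 (fun i hi y => ?_) hr hδ
  exact norm_iteratedFDeriv_perSum_le (hW.of_le (by exact_mod_cast le_top)) hWs (hM i hi) y

/-- **One-sided time derivative.** `∂ₜ|_S U (t, x) = ∂ₜ|_S u(·, repr x)(t)` for `t ∈ S`.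
[folklore] -/
theorem timeDerivWithin_periodize_slice (hK : IsClosed K)
    (hKsub : K ⊆ {y | ∀ i, y i ∈ Ioo (0 : ℝ) 1}) (h0 : ∀ t ∈ S, ∀ y ∉ K, u t y = 0) {t : ℝ}
    (ht : t ∈ S) (x : UnitAddTorus d) :
    timeDerivWithin S (fun s => periodize (u s)) t x = derivWithin (fun s => u s (repr x)) S t := by
  unfold timeDerivWithin
  exact derivWithin_congr (fun s hs => periodize_slice_apply hK hKsub (h0 s hs) x)
    (periodize_slice_apply hK hKsub (h0 t ht) x)

omit [DecidableEq d] in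
/-- Space slices of the planar field are smooth with topological support in the open cube.
[folklore] -/
theorem contDiff_slice_and_tsupport (hu : ContDiffOn ℝ ∞ (uncurry u) (S ×ˢ univ))
    (hK : IsClosed K) (hKsub : K ⊆ {y | ∀ i, y i ∈ Ioo (0 : ℝ) 1})
    (h0 : ∀ t ∈ S, ∀ y ∉ K, u t y = 0) {t : ℝ} (ht : t ∈ S) :
    ContDiff ℝ ∞ (u t) ∧ tsupport (u t) ⊆ {y | ∀ i, y i ∈ Ioo (0 : ℝ) 1} :=
  ⟨hu.contDiff_slice ht, tsupport_slice_subset_openCube hK hKsub (h0 t ht)⟩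

omit [Fintype d] [DecidableEq d] in
/-- The Fréchet derivative of a slice vanishes off `K` (the slice is zero near such points).
[folklore] -/
theorem fderiv_slice_eq_zero (hK : IsClosed K) {t : ℝ} (h0 : ∀ y ∉ K, u t y = 0)
    {z : EuclideanSpace ℝ d} (hz : z ∉ K) : _root_.fderiv ℝ (u t) z = 0 := by
  have h : u t =ᶠ[𝓝 z] fun _ => 0 :=
    Filter.eventuallyEq_of_mem (hK.isOpen_compl.mem_nhds hz) fun y hy => h0 y hy
  rw [h.fderiv_eq]
  simp

/-- **Fréchet derivative.** `D(U t)(x) = D(u t)(repr x)` for `t ∈ S`. [folklore] -/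
theorem fderiv_periodize_slice (hu : ContDiffOn ℝ ∞ (uncurry u) (S ×ˢ univ)) (hK : IsClosed K)
    (hKsub : K ⊆ {y | ∀ i, y i ∈ Ioo (0 : ℝ) 1}) (h0 : ∀ t ∈ S, ∀ y ∉ K, u t y = 0) {t : ℝ}
    (ht : t ∈ S) (x : UnitAddTorus d) :
    Torus.fderiv (periodize (u t)) x = _root_.fderiv ℝ (u t) (repr x) := by
  obtain ⟨hc, hs⟩ := contDiff_slice_and_tsupport hu hK hKsub h0 ht
  rw [fderiv_periodize' (hc.of_le (by exact_mod_cast le_top)) (tsupport_subset_closedBall_of_openCube hs)]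
  exact perSum_eq_self_of_mem_unitCube (fun z hz => fderiv_slice_eq_zero hK (h0 t ht)
    fun hzK => hz (hKsub hzK)) (repr_mem_unitCube x)

/-- **Gradient.** `∇(U t)(x) = ∇(u t)(repr x)` for a scalar field, `t ∈ S`. [folklore] -/
theorem gradient_periodize_slice {u : ℝ → EuclideanSpace ℝ d → ℝ}
    (hu : ContDiffOn ℝ ∞ (uncurry u) (S ×ˢ univ)) (hK : IsClosed K)
    (hKsub : K ⊆ {y | ∀ i, y i ∈ Ioo (0 : ℝ) 1}) (h0 : ∀ t ∈ S, ∀ y ∉ K, u t y = 0) {t : ℝ}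
    (ht : t ∈ S) (x : UnitAddTorus d) :
    Torus.gradient (periodize (u t)) x = _root_.gradient (u t) (repr x) := by
  rw [Torus.gradient, _root_.gradient, _root_.gradient, ← Torus.fderiv,
    fderiv_periodize_slice hu hK hKsub h0 ht x]

/-- **Convective term.** `((U s·∇)U s)(x) = D(u s)(repr x)[u s (repr x)]` for `s ∈ S`.
[folklore] -/
theorem convect_periodize_slice {u : ℝ → EuclideanSpace ℝ d → EuclideanSpace ℝ d}
    (hu : ContDiffOn ℝ ∞ (uncurry u) (S ×ˢ univ)) (hK : IsClosed K)
    (hKsub : K ⊆ {y | ∀ i, y i ∈ Ioo (0 : ℝ) 1}) (h0 : ∀ t ∈ S, ∀ y ∉ K, u t y = 0) {s : ℝ}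
    (hs : s ∈ S) (x : UnitAddTorus d) :
    Torus.convect (periodize (u s)) (periodize (u s)) x =
      _root_.fderiv ℝ (u s) (repr x) (u s (repr x)) := by
  rw [Torus.convect, fderiv_periodize_slice hu hK hKsub h0 hs x, periodize_slice_apply hK hKsub (h0 s hs)]

/-- **Incompressibility.** If `tr D(u t)(z) = 0` for all `z`, then `U t` is divergence free on
`T^d` (`t ∈ S`). [folklore] -/
theorem isDivFree_periodize_slice {u : ℝ → EuclideanSpace ℝ d → EuclideanSpace ℝ d}
    (hu : ContDiffOn ℝ ∞ (uncurry u) (S ×ˢ univ)) (hK : IsClosed K)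
    (hKsub : K ⊆ {y | ∀ i, y i ∈ Ioo (0 : ℝ) 1}) (h0 : ∀ t ∈ S, ∀ y ∉ K, u t y = 0) {t : ℝ}
    (ht : t ∈ S)
    (hdiv : ∀ z, LinearMap.trace ℝ _ (_root_.fderiv ℝ (u t) z : EuclideanSpace ℝ d →ₗ[ℝ] _) = 0) :
    IsDivFree (periodize (u t)) := by
  obtain ⟨hc, hs⟩ := contDiff_slice_and_tsupport hu hK hKsub h0 ht
  have h1 : IsContDiff 1 (periodize (u t)) :=
    isContDiff_periodize (hc.of_le (by exact_mod_cast le_top)) (tsupport_subset_closedBall_of_openCube hs)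
  rw [isDivFree_iff_trace_fderiv_lift h1]
  intro y
  rw [fderiv_lift, fderiv_periodize_slice hu hK hKsub h0 ht]
  exact hdiv _

end Field

/-! ## Integrals -/

section Integral

variable {K : Set (EuclideanSpace ℝ d)}

/-- **Integral.** For a continuous `g` vanishing off a closed `K ⊆ (0,1)^d`:
`∫_{T^d} periodize g = ∫_{ℝ^d} g`. [folklore] -/
theorem integral_periodize_of_cube {g : EuclideanSpace ℝ d → F} (hg : Continuous g)
    (hK : IsClosed K) (hKsub : K ⊆ {y | ∀ i, y i ∈ Ioo (0 : ℝ) 1}) (h0 : ∀ y ∉ K, g y = 0) :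
    ∫ x, periodize g x = ∫ y, g y := by
  have hs : support g ⊆ closedBall 0 (Fintype.card d) :=
    support_subset_closedBall_of_cube (eq_zero_of_tsupport_subset_openCube
      ((closure_minimal (fun y hy => by_contra fun hc => (Function.mem_support.1 hy) (h0 y hc)) hK).trans
    hKsub))
  have hgi : Integrable g volume := by
    refine hg.integrable_of_hasCompactSupport ?_
    exact HasCompactSupport.of_support_subset_isCompact (isCompact_closedBall 0 _) hs
  rw [integral_eq_integral_perSum_repr hgi hs]
  rfl

/-- **Integral of the square.** For a continuous real `g` vanishing off a closed `K ⊆ (0,1)^d`: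
`∫_{T^d} (periodize g)² = ∫_{ℝ^d} g²`. [folklore] -/
theorem integral_periodize_sq_of_cube {g : EuclideanSpace ℝ d → ℝ} (hg : Continuous g)
    (hK : IsClosed K) (hKsub : K ⊆ {y | ∀ i, y i ∈ Ioo (0 : ℝ) 1}) (h0 : ∀ y ∉ K, g y = 0) :
    ∫ x, periodize g x ^ 2 = ∫ y, g y ^ 2 := by
  have h2 : ∀ y ∉ K, (fun y => g y ^ 2) y = 0 := fun y hy => by simp [h0 y hy]
  rw [← integral_periodize_of_cube (g := fun y => g y ^ 2) (hg.pow 2) hK hKsub h2]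
  refine integral_congr_ae (Filter.Eventually.of_forall fun x => ?_)
  have hK0 : ∀ y, (¬ ∀ i, y i ∈ Ioo (0 : ℝ) 1) → g y = 0 := fun y hy => h0 y fun h => hy (hKsub h)
  have hK2 : ∀ y, (¬ ∀ i, y i ∈ Ioo (0 : ℝ) 1) → (fun y => g y ^ 2) y = 0 := fun y hy => by
    simp [hK0 y hy]
  simp only [periodize_eq_apply_repr hK0, periodize_eq_apply_repr hK2]

end Integral

end Torus

end Literature.Analysis.FunctionSpaces

end
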